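import Summits.QuantumFields.YangMills.Theorems.DiagonalMirrorRPRDiagonalSliceModelDefs
import Summits.QuantumFields.YangMills.Theorems.MirrorModularBoostsHypercubicLimitTranslationPlanesSeam
import Summits.QuantumFields.YangMills.Theorems.MirrorModularBoostsHypercubicLimitSubschemeDefs

/-!
# Crux `WeakCouplingHypercubicLimitRP` (stmt-QuantumFields-27398), line `Sketch`, stub D1 `stub_diagRPOfPlaneLimits`, door B:
# the sup-norm growth of the family observable `Y_k(F)` under the PRODUCT-FORM renormalisation clause, and that clause
# from D1's own hypotheses `PolyRenorm` + `UniformFunctionalBoundPlanes` (also along a subsequence)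

Helper file (`--supports stmt-QuantumFields-27398 --as helper`) of the hand `hand-10604-wilsonDiagModel-2` (docket director-ym g23,
O4 WORD 18 (3)(ii): door-B suppliers along `φ`) for the registered stub D1 `stub_diagRPOfPlaneLimits` of
`Cruxes/WeakCouplingHypercubicLimitRP/Lines/Sketch.lean` (sha16 `7bf38c709623ad77`); it closes nothing by itself.

THE LOCATED GAP IT REPAIRS (door-B internal).  The door-B core (`Cruxes/DiagonalMirrorRPR/Lines/sign_twisted_diagonal_trace_core.lean`,
sha16 `2db7ee148edeb495`) bounds `‖Y_k(F)‖_∞` by `K (a_k⁻¹)^P (a_k side_k)^Q` (`famObs_supGrowth`) from its clause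
`TemperateRenormalisation r sch : ∃ p, ∀ᶠ k, |c_k| ≤ (a_k⁻¹)^p ∧ |m_k| ≤ (a_k⁻¹)^p`, whose `m`-half (`PolyCounterterm`) is NOT among D1's
hypotheses (`HasWeakCouplingLimit`, `PolyVolume`, `PolyRenorm`, `UniformFunctionalBoundPlanes`, `RPSpectral`, `PlaneLimits`) and is NOT derivable
from them: a scheme with `c_k → 0` fast and `c_k m_k` bounded is admissible.  What D1's hypotheses DO give is the PRODUCT FORM
`∃ p, ∀ᶠ k, |c_k| ≤ (a_k⁻¹)^p ∧ |c_k · m_k| ≤ (a_k⁻¹)^p` (§3: `PolyRenorm` is the `c`-half; the arity-one uniform functional bound tested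
against a non-negative bump bounds the renormalised one-point weight `c_k a_k⁴ (⟨p⟩_k − m_k/6)` uniformly in `k` — the tree's
`exists_bound_renorm_weight_one` / `renormScale_le` of the coupling-response seam file — whence `|c_k m_k| ≤ 6(2C + A) a_k^{-(Q+4)}`), and the
family observable depends on `(c_k, m_k)` only through `c_k·F − c_k·m_k`, so the sup-growth bound goes through under the product form VERBATIM
(§1 per-factor bound `(|a|(2L+1))⁴ · H · (|c| C₀ + |c m|)`, §2 `famObs_supGrowth_prod` with the SAME conclusion shape as the core's
`famObs_supGrowth`; the old clause implies the product form with exponent `2p`, `productRenorm_of_temperate`).  Consequence for the core: in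
`core_of` replace `famObs_supGrowth hG.1 F` by `famObs_supGrowth_prod hT F` and weaken `Growth`'s first conjunct to the product form; then
`Growth r (subseq sch φ hφ)` is a THEOREM of D1's hypotheses (`productRenorm_subseq_of_polyRenorm_of_ufb` below + the tree's `polyVolume_subseq` +
the core's `sideGrowth_of_polyVolume`), i.e. door B's scheme letter is discharged and only the model letters R1 `OddTwistGap` / R2 `DiagLukewarm` remain.

HONEST FRAMING: bookkeeping/estimates only.  No model letter is proved; `wilsonDiagonalModel` is not landed; D1, the crux ⟨27398⟩ and its heart S6i
are OPEN; nothing here bears on the summit; the Yang–Mills mass gap is NOT proved here or anywhere in the tree.  No new `Prop` definition, no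
instance, no notation, `autoImplicit false`.

References: Osterwalder–Seiler, Ann. Phys. 110 (1978) §2–3; Seiler, LNP 159 (1982) Ch. 2 (lattice fields, renormalised plaquette observables).
-/

set_option autoImplicit false

noncomputable section

open scoped SchwartzMap
open MeasureTheory Filter Topology
open Literature.MathematicalPhysics.QuantumLattice Literature.MathematicalPhysics.AQFT
  Literature.MathematicalPhysics.QuantumFieldTheory Literature.Probability.LatticeModels
open Summit.QuantumFields.YangMills.Cruxes.DiagonalMirrorRPR.ParityBridgeColdTraces (E4)
open Summit.QuantumFields.YangMills.Cruxes.HypercubicLimit.CouplingResponse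
  (subseq PolyRenorm UniformFunctionalBoundPlanes Plane planeSpecies exists_bound_planeSpecies exists_bound_renorm_weight_one
    renormScale_le polyRenorm_subseq)

namespace Summit.QuantumFields.YangMills.Cruxes.DiagonalMirrorRPR.SignTwistedDiagonalTrace

/-! ## §1 Per-factor sup bound in product form -/

section PerFactor

variable {G : Type} [Group G] [MeasurableSpace G]

/-- Sup bound of one smeared field on the torus box in PRODUCT form: `|Φ(h)(V)| ≤ (|a|(2L+1))⁴ · H · (|c| C₀ + |c·m|)` — the
renormalisation data enter only through `|c|` and `|c·m|` (`Φ(h) = a⁴ Σₓ h(ax) (c·O(τₓV) − c·m)`). -/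
theorem abs_smearedLatticeField_le_side_prod (O : YMSpecies G) (L : ℕ) (a cc m : ℝ) (h : 𝓢(E4, ℝ)) {H C₀ : ℝ}
    (hH : ∀ x, |h x| ≤ H) (hC₀ : ∀ U, |O.F U| ≤ C₀) (V : LGConfig 4 G) :
    |smearedLatticeField O.F (box 4 L) a cc m h V| ≤ (|a| * (2 * L + 1)) ^ 4 * H * (|cc| * C₀ + |cc * m|) := by
  have hH0 : 0 ≤ H := (abs_nonneg _).trans (hH 0)
  have hC₀0 : 0 ≤ C₀ := (abs_nonneg _).trans (hC₀ V)
  unfold smearedLatticeField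
  have hrw : cc * a ^ 4 * ∑ x ∈ box 4 L, h (a • siteToE x) * (O.F (configShift (-x) V) - m) =
      a ^ 4 * ∑ x ∈ box 4 L, h (a • siteToE x) * (cc * O.F (configShift (-x) V) - cc * m) := by
    rw [mul_comm cc, mul_assoc, Finset.mul_sum]
    congr 1
    exact Finset.sum_congr rfl fun x _ => by ring
  rw [hrw, abs_mul, abs_pow]
  have hterm : ∀ x ∈ box 4 L, |h (a • siteToE x) * (cc * O.F (configShift (-x) V) - cc * m)| ≤ H * (|cc| * C₀ + |cc * m|) := by
    intro x _
    rw [abs_mul]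
    refine mul_le_mul (hH _) ((abs_sub _ _).trans (add_le_add ?_ le_rfl)) (abs_nonneg _) hH0
    rw [abs_mul]
    exact mul_le_mul_of_nonneg_left (hC₀ _) (abs_nonneg _)
  have hsum : |∑ x ∈ box 4 L, h (a • siteToE x) * (cc * O.F (configShift (-x) V) - cc * m)| ≤
      ((2 * L + 1) ^ 4 : ℝ) * (H * (|cc| * C₀ + |cc * m|)) := by
    refine (Finset.abs_sum_le_sum_abs _ _).trans ?_
    refine (Finset.sum_le_card_nsmul _ _ (H * (|cc| * C₀ + |cc * m|)) hterm).trans ?_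
    rw [card_box, nsmul_eq_mul]
    push_cast
    exact le_rfl
  calc |a| ^ 4 * |∑ x ∈ box 4 L, h (a • siteToE x) * (cc * O.F (configShift (-x) V) - cc * m)|
      ≤ |a| ^ 4 * (((2 * L + 1) ^ 4 : ℝ) * (H * (|cc| * C₀ + |cc * m|))) := mul_le_mul_of_nonneg_left hsum (by positivity)
    _ = (|a| * (2 * L + 1)) ^ 4 * H * (|cc| * C₀ + |cc * m|) := by ring

end PerFactor

/-! ## §2 Sup-norm growth of the family observable under the product-form clause -/

section SupGrowth

variable {G : Type} [Group G] [TopologicalSpace G] [IsTopologicalGroup G] [CompactSpace G]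
  [MeasurableSpace G] [BorelSpace G] {r : LatticeRep G} {sch : SpeciesScheme (YMSpecies G)}

omit [TopologicalSpace G] [IsTopologicalGroup G] [CompactSpace G] [BorelSpace G] in
/-- `a_k · side_k → ∞` (as in the core). -/
theorem tendsto_a_mul_side' (sch : SpeciesScheme (YMSpecies G)) :
    Tendsto (fun k => sch.a k * (sch.side k : ℝ)) atTop atTop := by
  refine tendsto_atTop_mono (fun k => ?_) sch.tendsto_L
  have ha := (sch.a_pos k).le
  have : (sch.L k : ℝ) ≤ (sch.side k : ℝ) := by
    simp only [SpeciesScheme.side]; push_cast; linarith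
  exact mul_le_mul_of_nonneg_left this ha

/-- **Sup-norm growth of the family observable under the PRODUCT-FORM clause** `|c_k| ≤ (a_k⁻¹)^p ∧ |c_k m_k| ≤ (a_k⁻¹)^p`
(eventually): `‖Y_k(F)‖_∞ ≤ K · (a_k⁻¹)^P · (a_k side_k)^Q` eventually — the SAME conclusion as the core's `famObs_supGrowth`, so
`core_of` runs unchanged on it (box cardinality `(2L_k+1)⁴`, bounded Schwartz functions, bounded curvature observable,
`abs_smearedLatticeField_le_side_prod`). -/
theorem famObs_supGrowth_prod {p : ℕ}
    (hT : ∀ᶠ k in atTop, |sch.c r.curvature k| ≤ (sch.a k)⁻¹ ^ p ∧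
      |sch.c r.curvature k * sch.m r.curvature k| ≤ (sch.a k)⁻¹ ^ p)
    (F : ReflectedFamily) :
    ∃ (K : ℝ) (P Q : ℕ), ∀ᶠ k in atTop, ∀ V,
      |famObs r sch F k V| ≤ K * (sch.a k)⁻¹ ^ P * (sch.a k * sch.side k) ^ Q := by
  obtain ⟨C₀, hC₀⟩ := r.curvature.bounded
  -- a uniform sup bound of the test functions
  have hHij : ∀ i j, ∃ H : ℝ, 0 ≤ H ∧ ∀ x, |F.f i j x| ≤ H := by
    intro i j
    obtain ⟨H, hHpos, hH⟩ := (F.f i j).decay 0 0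
    refine ⟨H, hHpos.le, fun x => ?_⟩
    have := hH x
    simpa [norm_iteratedFDeriv_zero, Real.norm_eq_abs] using this
  choose Hf hHf0 hHf using hHij
  set H : ℝ := max (∑ i, ∑ j, Hf i j) 1 with hH_def
  have hH1 : 1 ≤ H := le_max_right _ _
  have hH0 : 0 ≤ H := zero_le_one.trans hH1
  have hHle : ∀ i j x, |F.f i j x| ≤ H := by
    intro i j x
    refine (hHf i j x).trans (le_trans ?_ (le_max_left _ _))
    calc Hf i j ≤ ∑ j', Hf i j' := Finset.single_le_sum (fun j' _ => hHf0 i j') (Finset.mem_univ j)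
      _ ≤ ∑ i', ∑ j', Hf i' j' :=
        Finset.single_le_sum (f := fun i' => ∑ j', Hf i' j') (fun i' _ => Finset.sum_nonneg fun j' _ => hHf0 i' j')
          (Finset.mem_univ i)
  have hC₀0 : 0 ≤ C₀ := (abs_nonneg _).trans (hC₀ fun _ => 1)
  set N : ℕ := ∑ i, F.n i with hN_def
  have hnN : ∀ i, F.n i ≤ N := fun i => Finset.single_le_sum (f := F.n) (fun i _ => Nat.zero_le _) (Finset.mem_univ i)
  refine ⟨(∑ i, |F.c i|) * (H * (C₀ + 1)) ^ N, p * N, 4 * N, ?_⟩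
  have ha1 : ∀ᶠ k in atTop, sch.a k ≤ 1 :=
    ((tendsto_order.1 sch.tendsto_a).2 1 one_pos).mono fun k hk => hk.le
  filter_upwards [hT, ha1, (tendsto_a_mul_side' sch).eventually_ge_atTop 1] with k hk ha1k hx1 V
  have ha0 : 0 < sch.a k := sch.a_pos k
  have hainv1 : 1 ≤ (sch.a k)⁻¹ := (one_le_inv₀ ha0).2 ha1k
  have hside : (2 * (sch.L k : ℝ) + 1) = (sch.side k : ℝ) := by
    simp only [SpeciesScheme.side]; push_cast; ring
  -- the per-factor bound `D ≥ 1`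
  set D : ℝ := H * (C₀ + 1) * ((sch.a k)⁻¹ ^ p * (sch.a k * sch.side k) ^ 4) with hD_def
  have hD1 : 1 ≤ D := by
    have h1 : (1 : ℝ) ≤ H * (C₀ + 1) := by nlinarith
    have h2 : (1 : ℝ) ≤ (sch.a k)⁻¹ ^ p := one_le_pow₀ hainv1
    have h3 : (1 : ℝ) ≤ (sch.a k * sch.side k) ^ 4 := one_le_pow₀ hx1
    have h23 : (1 : ℝ) ≤ (sch.a k)⁻¹ ^ p * (sch.a k * sch.side k) ^ 4 := by nlinarith
    nlinarith
  have hfac : ∀ i j, |smearedLatticeField r.curvature.F (box 4 (sch.L k)) (sch.a k) (sch.c r.curvature k)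
      (sch.m r.curvature k) (F.f i j) V| ≤ D := by
    intro i j
    refine (abs_smearedLatticeField_le_side_prod r.curvature (sch.L k) (sch.a k) _ _ (F.f i j) (hHle i j) hC₀ V).trans ?_
    rw [abs_of_pos ha0, hside]
    have h1 : |sch.c r.curvature k| * C₀ ≤ (sch.a k)⁻¹ ^ p * C₀ := mul_le_mul_of_nonneg_right hk.1 hC₀0
    have h2 : |sch.c r.curvature k * sch.m r.curvature k| ≤ (sch.a k)⁻¹ ^ p := hk.2
    calc (sch.a k * sch.side k) ^ 4 * H * (|sch.c r.curvature k| * C₀ + |sch.c r.curvature k * sch.m r.curvature k|)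
        ≤ (sch.a k * sch.side k) ^ 4 * H * ((sch.a k)⁻¹ ^ p * C₀ + (sch.a k)⁻¹ ^ p) :=
          mul_le_mul_of_nonneg_left (add_le_add h1 h2) (by positivity)
      _ = D := by rw [hD_def]; ring
  -- products and the sum
  have hprod : ∀ i, |∏ j, smearedLatticeField r.curvature.F (box 4 (sch.L k)) (sch.a k) (sch.c r.curvature k)
      (sch.m r.curvature k) (F.f i j) V| ≤ D ^ N := by
    intro i
    rw [Finset.abs_prod]
    calc ∏ j, |smearedLatticeField r.curvature.F (box 4 (sch.L k)) (sch.a k) (sch.c r.curvature k)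
          (sch.m r.curvature k) (F.f i j) V| ≤ ∏ _j : Fin (F.n i), D :=
          Finset.prod_le_prod (fun j _ => abs_nonneg _) fun j _ => hfac i j
      _ = D ^ F.n i := by rw [Finset.prod_const, Finset.card_univ, Fintype.card_fin]
      _ ≤ D ^ N := pow_le_pow_right₀ hD1 (hnN i)
  calc |famObs r sch F k V|
      ≤ ∑ i, |F.c i * ∏ j, smearedLatticeField r.curvature.F (box 4 (sch.L k)) (sch.a k) (sch.c r.curvature k)
          (sch.m r.curvature k) (F.f i j) V| := Finset.abs_sum_le_sum_abs _ _
    _ ≤ ∑ i, |F.c i| * D ^ N := Finset.sum_le_sum fun i _ => by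
        rw [abs_mul]
        exact mul_le_mul_of_nonneg_left (hprod i) (abs_nonneg _)
    _ = (∑ i, |F.c i|) * (H * (C₀ + 1)) ^ N * (sch.a k)⁻¹ ^ (p * N) * (sch.a k * sch.side k) ^ (4 * N) := by
        rw [← Finset.sum_mul, hD_def, mul_pow, mul_pow, mul_pow, ← pow_mul, ← pow_mul]
        ring

/-- The core's clause implies the product form (exponent doubled): `|c_k|,|m_k| ≤ (a_k⁻¹)^p ⇒ |c_k|,|c_k m_k| ≤ (a_k⁻¹)^{2p}` eventually
(`a_k ≤ 1` eventually). -/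
theorem productRenorm_of_temperate {p : ℕ}
    (hT : ∀ᶠ k in atTop, |sch.c r.curvature k| ≤ (sch.a k)⁻¹ ^ p ∧ |sch.m r.curvature k| ≤ (sch.a k)⁻¹ ^ p) :
    ∀ᶠ k in atTop, |sch.c r.curvature k| ≤ (sch.a k)⁻¹ ^ (2 * p) ∧
      |sch.c r.curvature k * sch.m r.curvature k| ≤ (sch.a k)⁻¹ ^ (2 * p) := by
  have ha1 : ∀ᶠ k in atTop, sch.a k ≤ 1 :=
    ((tendsto_order.1 sch.tendsto_a).2 1 one_pos).mono fun k hk => hk.le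
  filter_upwards [hT, ha1] with k hk ha1k
  have hainv1 : 1 ≤ (sch.a k)⁻¹ := (one_le_inv₀ (sch.a_pos k)).2 ha1k
  refine ⟨hk.1.trans (pow_le_pow_right₀ hainv1 (by omega)), ?_⟩
  rw [abs_mul, two_mul, pow_add]
  exact mul_le_mul hk.1 hk.2 (abs_nonneg _) (pow_nonneg (zero_le_one.trans hainv1) _)

end SupGrowth

/-! ## §3 The product-form clause from D1's hypotheses `PolyRenorm` + `UniformFunctionalBoundPlanes` -/

section FromUfb

variable {G : Type} [Group G] [TopologicalSpace G] [IsTopologicalGroup G] [CompactSpace G]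
  [MeasurableSpace G] [BorelSpace G] (r : LatticeRep G) (sch : SpeciesScheme (YMSpecies G))

/-- **The product-form renormalisation clause from D1's own hypotheses.**  `PolyRenorm r sch` (`|c_k| ≤ a_k^{-Q}`) and
`UniformFunctionalBoundPlanes r sch` give `∃ p, ∀ᶠ k, |c_k| ≤ (a_k⁻¹)^p ∧ |c_k m_k| ≤ (a_k⁻¹)^p`.  Proof: the arity-one functional bound
tested against a non-negative bump bounds the renormalised one-point weight `|c_k a_k⁴ (⟨p⟩_k − m_k/6)| ≤ A` uniformly in `k`
(`exists_bound_renorm_weight_one`), whence `|c_k a_k⁴| (C + |m_k/6|) ≤ (2C + A) a_k^{-Q}` (`renormScale_le`), so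
`|c_k m_k| ≤ 6 (2C + A) a_k^{-(Q+4)} ≤ a_k^{-(Q+5)}` once `a_k ≤ 1/(6(2C + A) + 1)`. -/
theorem productRenorm_of_polyRenorm_of_ufb (hc : PolyRenorm r sch) (hU : UniformFunctionalBoundPlanes r sch) :
    ∃ p : ℕ, ∀ᶠ k in atTop, |sch.c r.curvature k| ≤ (sch.a k)⁻¹ ^ p ∧
      |sch.c r.curvature k * sch.m r.curvature k| ≤ (sch.a k)⁻¹ ^ p := by
  obtain ⟨Q, hQ⟩ := hc
  obtain ⟨C, hC0, hC⟩ := exists_bound_planeSpecies r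
  obtain ⟨A, hA0, hA⟩ := exists_bound_renorm_weight_one r sch hU
  set B : ℝ := 6 * (2 * C + A) + 1 with hB_def
  have hB1 : 1 ≤ B := by rw [hB_def]; nlinarith
  have hB0 : 0 < B := zero_lt_one.trans_le hB1
  refine ⟨Q + 5, ?_⟩
  have ha1 : ∀ᶠ k in atTop, sch.a k ≤ 1 :=
    ((tendsto_order.1 sch.tendsto_a).2 1 one_pos).mono fun k hk => hk.le
  have haB : ∀ᶠ k in atTop, sch.a k ≤ B⁻¹ :=
    ((tendsto_order.1 sch.tendsto_a).2 B⁻¹ (inv_pos.2 hB0)).mono fun k hk => hk.le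
  filter_upwards [ha1, haB] with k ha1k haBk
  have ha := sch.a_pos k
  set a : ℝ := sch.a k with ha_def
  set c : ℝ := sch.c r.curvature k with hc_def
  set m : ℝ := sch.m r.curvature k with hm_def
  have hainv1 : 1 ≤ a⁻¹ := (one_le_inv₀ ha).2 ha1k
  have hscale : |c * a ^ 4| * (C + |m / 6|) ≤ (2 * C + A) * a⁻¹ ^ Q := renormScale_le r sch hC0 hC hA hQ k ha1k
  refine ⟨(hQ k).trans (pow_le_pow_right₀ hainv1 (by omega)), ?_⟩
  -- `|c m| = 6 · a⁻⁴ · (|c a⁴| · |m/6|) ≤ 6 (2C + A) a^{-(Q+4)}`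
  have h1 : |c * a ^ 4| * |m / 6| ≤ (2 * C + A) * a⁻¹ ^ Q := by
    refine le_trans ?_ hscale
    exact mul_le_mul_of_nonneg_left (le_add_of_nonneg_left hC0) (abs_nonneg _)
  have hcm : |c * m| = 6 * a⁻¹ ^ 4 * (|c * a ^ 4| * |m / 6|) := by
    rw [abs_mul, abs_mul, abs_div, abs_of_pos (pow_pos ha 4), abs_of_pos (by norm_num : (0 : ℝ) < 6), inv_pow]
    field_simp
  have h2 : |c * m| ≤ 6 * (2 * C + A) * a⁻¹ ^ (Q + 4) := by
    rw [hcm, pow_add]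
    have h6 : (0 : ℝ) ≤ 6 * a⁻¹ ^ 4 := by positivity
    calc 6 * a⁻¹ ^ 4 * (|c * a ^ 4| * |m / 6|) ≤ 6 * a⁻¹ ^ 4 * ((2 * C + A) * a⁻¹ ^ Q) :=
          mul_le_mul_of_nonneg_left h1 h6
      _ = 6 * (2 * C + A) * (a⁻¹ ^ Q * a⁻¹ ^ 4) := by ring
  -- absorb the constant: `6(2C + A) ≤ B ≤ a⁻¹`
  have hBa : B ≤ a⁻¹ := by
    rw [le_inv_comm₀ hB0 ha]
    exact haBk
  have h3 : 6 * (2 * C + A) ≤ a⁻¹ := le_trans (by rw [hB_def]; linarith) hBa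
  calc |c * m| ≤ 6 * (2 * C + A) * a⁻¹ ^ (Q + 4) := h2
    _ ≤ a⁻¹ * a⁻¹ ^ (Q + 4) := mul_le_mul_of_nonneg_right h3 (pow_nonneg (zero_le_one.trans hainv1) _)
    _ = a⁻¹ ^ (Q + 5) := by ring

/-- `UniformFunctionalBoundPlanes` restricts to sub-schemes (its clause is `∀ k`; same constants). -/
theorem uniformFunctionalBoundPlanes_subseq (φ : ℕ → ℕ) (hφ : StrictMono φ) (h : UniformFunctionalBoundPlanes r sch) :
    UniformFunctionalBoundPlanes r (subseq sch φ hφ) := by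
  obtain ⟨s, α, β, hb⟩ := h
  exact ⟨s, α, β, fun n q F hF k => hb n q F hF (φ k)⟩

/-- **The product-form clause ALONG `φ`** from D1's hypotheses on the SCHEME: `PolyRenorm r sch → UniformFunctionalBoundPlanes r sch →
∃ p, ∀ᶠ k, |c_{φ k}| ≤ (a_{φ k}⁻¹)^p ∧ |c_{φ k} m_{φ k}| ≤ (a_{φ k}⁻¹)^p` — i.e. the clause for `subseq sch φ hφ` (via `polyRenorm_subseq`,
`uniformFunctionalBoundPlanes_subseq`); feed it to `famObs_supGrowth_prod` on the sub-scheme. -/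
theorem productRenorm_subseq_of_polyRenorm_of_ufb (φ : ℕ → ℕ) (hφ : StrictMono φ) (hc : PolyRenorm r sch)
    (hU : UniformFunctionalBoundPlanes r sch) :
    ∃ p : ℕ, ∀ᶠ k in atTop, |(subseq sch φ hφ).c r.curvature k| ≤ ((subseq sch φ hφ).a k)⁻¹ ^ p ∧
      |(subseq sch φ hφ).c r.curvature k * (subseq sch φ hφ).m r.curvature k| ≤ ((subseq sch φ hφ).a k)⁻¹ ^ p :=
  productRenorm_of_polyRenorm_of_ufb r (subseq sch φ hφ) (polyRenorm_subseq r sch φ hφ hc)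
    (uniformFunctionalBoundPlanes_subseq r sch φ hφ hU)

end FromUfb

/-! ## §4 (appended) The κ3 shapes: `PolyRenormCounterterm` / re-typed `TemperateRenormalisation` of the κ3 core
(`Cruxes/DiagonalMirrorRPR/Lines/sign_twisted_diagonal_trace_core.lean` as re-typed by idea-crit-9 g12, bytes `900935a36c50070a`, director-ym
O4 WORD 19 (1)): bodies `|c_k| * |m_k| ≤ (a_k⁻¹)^p` resp. `|c_k| ≤ (a_k⁻¹)^p ∧ |c_k| * |m_k| ≤ (a_k⁻¹)^p`, unfolded VERBATIM (a `Theorems/`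
file cannot import the workfile), so that in the κ3 core `PolyRenormCounterterm r sch` / `TemperateRenormalisation r sch` — and the same on
`subseq sch φ hφ` — are discharged from D1's OWN binders by `exact` (definitional unfolding).  Adapter owner: hand-10604-wilsonDiagModel-2
(O4 WORD 19 (2), deliverable (ii-b)). -/

section Kappa3Shapes

variable {G : Type} [Group G] [TopologicalSpace G] [IsTopologicalGroup G] [CompactSpace G]
  [MeasurableSpace G] [BorelSpace G] (r : LatticeRep G) (sch : SpeciesScheme (YMSpecies G))

/-- **`polyRenormCounterterm_of_ufbPlanes`** (the κ3 adapter): `PolyRenorm r sch → UniformFunctionalBoundPlanes r sch →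
∃ p, ∀ᶠ k, |c_k| * |m_k| ≤ (a_k⁻¹)^p` — the body of the κ3 core's `PolyRenormCounterterm r sch`, so door B's `Growth` letter is supplied by
D1's own binders (`growth_of_polyRenormCounterterm` in the κ3 core). -/
theorem polyRenormCounterterm_of_ufbPlanes (hc : PolyRenorm r sch) (hU : UniformFunctionalBoundPlanes r sch) :
    ∃ p : ℕ, ∀ᶠ k in atTop, |sch.c r.curvature k| * |sch.m r.curvature k| ≤ (sch.a k)⁻¹ ^ p := by
  obtain ⟨p, hp⟩ := productRenorm_of_polyRenorm_of_ufb r sch hc hU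
  exact ⟨p, hp.mono fun k hk => by rw [← abs_mul]; exact hk.2⟩

/-- **The re-typed `TemperateRenormalisation` of the κ3 core from D1's binders**: `PolyRenorm r sch → UniformFunctionalBoundPlanes r sch →
∃ p, ∀ᶠ k, |c_k| ≤ (a_k⁻¹)^p ∧ |c_k| * |m_k| ≤ (a_k⁻¹)^p` (one common exponent). -/
theorem temperateRenormalisation_of_polyRenorm_of_ufbPlanes (hc : PolyRenorm r sch) (hU : UniformFunctionalBoundPlanes r sch) :
    ∃ p : ℕ, ∀ᶠ k in atTop, |sch.c r.curvature k| ≤ (sch.a k)⁻¹ ^ p ∧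
      |sch.c r.curvature k| * |sch.m r.curvature k| ≤ (sch.a k)⁻¹ ^ p := by
  obtain ⟨p, hp⟩ := productRenorm_of_polyRenorm_of_ufb r sch hc hU
  exact ⟨p, hp.mono fun k hk => ⟨hk.1, by rw [← abs_mul]; exact hk.2⟩⟩

/-- **The κ3 adapter ALONG `φ`**: the body of `PolyRenormCounterterm r (subseq sch φ hφ)` from D1's binders on the SCHEME. -/
theorem polyRenormCounterterm_subseq_of_ufbPlanes (φ : ℕ → ℕ) (hφ : StrictMono φ) (hc : PolyRenorm r sch)
    (hU : UniformFunctionalBoundPlanes r sch) :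
    ∃ p : ℕ, ∀ᶠ k in atTop, |(subseq sch φ hφ).c r.curvature k| * |(subseq sch φ hφ).m r.curvature k| ≤
      ((subseq sch φ hφ).a k)⁻¹ ^ p :=
  polyRenormCounterterm_of_ufbPlanes r (subseq sch φ hφ) (polyRenorm_subseq r sch φ hφ hc)
    (uniformFunctionalBoundPlanes_subseq r sch φ hφ hU)

/-- **The re-typed `TemperateRenormalisation` ALONG `φ`**: the body of `TemperateRenormalisation r (subseq sch φ hφ)` (κ3 core) from D1's
binders on the SCHEME — with the tree's `polyVolume_subseq` and the core's `sideGrowth_of_polyVolume` this is `Growth r (subseq sch φ hφ)`,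
door B's scheme letter at the sub-scheme where the transfer `diagRPOfPlaneLimits_of_swapPairingLiminf` (p827255) consumes the socket. -/
theorem temperateRenormalisation_subseq_of_polyRenorm_of_ufbPlanes (φ : ℕ → ℕ) (hφ : StrictMono φ) (hc : PolyRenorm r sch)
    (hU : UniformFunctionalBoundPlanes r sch) :
    ∃ p : ℕ, ∀ᶠ k in atTop, |(subseq sch φ hφ).c r.curvature k| ≤ ((subseq sch φ hφ).a k)⁻¹ ^ p ∧
      |(subseq sch φ hφ).c r.curvature k| * |(subseq sch φ hφ).m r.curvature k| ≤ ((subseq sch φ hφ).a k)⁻¹ ^ p :=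
  temperateRenormalisation_of_polyRenorm_of_ufbPlanes r (subseq sch φ hφ) (polyRenorm_subseq r sch φ hφ hc)
    (uniformFunctionalBoundPlanes_subseq r sch φ hφ hU)

end Kappa3Shapes

end Summit.QuantumFields.YangMills.Cruxes.DiagonalMirrorRPR.SignTwistedDiagonalTrace

end
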